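import Summits.QuantumFields.YangMills.Theorems.BalabanUVNodesN16KingModelTwoRun

/-!
# Route «BalabanUVNodes» (K3⁵ `SpineGivenEndpointR13SepCoP`), DAG node N16 = NE3 — THE KING-MODEL RUNG OF NE3, DERIVATIVE LINE,
# PART 1 (pure lattice bookkeeping): THE BLOCK-MEAN ∕ DIFFERENCE COMMUTATION — the forward difference of an `n`-fold block mean
# `Q_nf` on the coarse torus is the block mean of the `Lⁿ`-step differences of `f`, i.e. the mean over the fibre AND over
# `j < Lⁿ` of the fine forward differences at `x′ + j·e_μ`; and WHERE those fine points lie (over `x` or over `x + e_μ`)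

Cell `pub-ymgap`, seat `pub-ymgap-dag-n16-c` (R134 acceleration seat, strategy s1; HUMAN RULING D-0062; chair R424 venue), generation 8.
`--kind proof --supports stmt-QuantumFields-20296 --as helper` (K3⁵, plan g68 KEY-20 ∕ dag-lead WORDS-141).  `bears_on: R4∕N16 · row «R2^ϱ,
the unprinted core»`.

WHY THIS FILE.  Generation 7 (`BalabanUVNodesN16KingModelTwoRun`) typed NE3's LOCAL HALF in King's `A = 0` scalar model: the VALUE of
the two-run minimiser discrepancy `D(x) = φ_k^ψ(x) − (Q_nφ_{k+n}^ψ)(x)` (run A at level `k`; run B at level `k + n` block-averaged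
`n` times back to run A's lattice) is `O((L^{−γ∕2})^k)` with one level- and volume-free constant.  The statement of record
`NE3EnergyWeightedCovShape.NE3EnergyRateWCov` carries, besides the value of the discrepancy direction `Z`, the conjunct (Lip₁ᶜ)
«first covariant differences of `Z` decay one power faster».  Its scalar template is the LATTICE DERIVATIVE of `D`,
`∂^η_μD(x) = Lᵏ·(D(x + e_μ) − D(x))`, and King's printed input for it is Prop. 3.8 (3.71) LINE 2 (`MinimizerTwoSpacingDeriv`,
seat n18-b), which compares `∂^{η′}_μℋ_{k+n}` at a fine point `x′` with `∂^η_μℋ_k` at the coarse point `x` UNDER `x′`.  The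
derivative of a block MEAN, however, reads fine points of the NEXT block too.  This file isolates the lattice bookkeeping
(no analysis, every volume, every function `f`):
  `Lᵏ·((Q_nf)(x + e_μ) − (Q_nf)(x)) = |Bⁿ(x)|⁻¹ Σ_{x′ over x} L⁻ⁿ Σ_{j<Lⁿ} LⁿLᵏ·(f(x′ + j·e_μ + e_μ) − f(x′ + j·e_μ))`
(the fibre of `x + e_μ` is the fibre of `x` translated by `Lⁿ·e_μ`; telescoping along `μ`), and: for `x′` over `x` and
`j < Lⁿ` the point `x′ + j·e_μ` lies over `x` OR over `x + e_μ` — the dichotomy that makes generation 8's PART 2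
(`BalabanUVNodesN16KingModelTwoRunDeriv`) patch the second case with King's Hölder line.

WHAT THIS FILE PROVES (kernel; theorems only — 0 `def`, 0 sorry; tori `Tor K = Π_μ ℤ∕K_μ` of `B5Prop11Plancherel`, `e_μ = unitVec`,
fibre of `x` spelled INLINE as in generation 7: `univ.filter (fun x′ ↦ ∀ ν, x_ν = ⌊x′_ν∕Lⁿ⌋)`):
* §1 components of `x + c·e_μ` (`add_nsmul_unitVec_apply_ne`, `val_add_nsmul_unitVec_apply_self`, …), the period
  `K_μ·e_μ = 0` (`period_nsmul_unitVec`), and `tdistT_add_unitVec_eq_one`: neighbours are at torus distance EXACTLY `1` once `K_μ ≥ 2`.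
* §2 `over_add_nsmul` (x′ over x ⇒ `x′ + cLⁿ·e_μ` over `x + c·e_μ`), ★ `over_add_nsmul_cases` (x′ over x, `j < Lⁿ` ⇒ `x′ + j·e_μ`
  over `x` ∨ over `x + e_μ`), `over_sub_nsmul`, `overFib_shift_eq_map` (fibre of `x + e_μ` = fibre of `x` translated by `Lⁿ·e_μ`).
* §3 `blockMean_shift`, `sub_eq_sum_range` (telescoping), ★ `coarseDeriv_blockMean_eq` (the displayed commutation identity), and the
  generic mean lemmas `blockMean_le`, `abs_blockMean_le`, `blockMean_sum_comm` used by PART 2.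

HONEST FRAMING.  Lattice bookkeeping for a MODEL LAYER (King's `A = 0` scalar minimisers — template literature, printed AND proved);
nothing of [Balaban1985RegularSpaces] ∕ [Balaban1985Variational] is proved; N16 ∕ NE3 is NOT discharged (in-edges N05, N07 remain
hypotheses of the chain of record); count-neutral; finite tori — NOT ℝ⁴, NOT infinite volume, NOT OS, NOT a mass gap, NOT Clay.

Sources: C. King, *The U(1) Higgs model. I. The continuum limit*, Commun. Math. Phys. **102** (1986) 649–677 [King1986], (2.4) p. 652
(block average), Prop. 3.8 (3.71) p. 664 («x′ ∈ Bⁿ(x)»), (4.1) p. 670.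
-/

set_option autoImplicit false

noncomputable section

open Finset
open scoped BigOperators

namespace Summit.QuantumFields.YangMills.BalabanUVNodes.N16KingModelBlockShift

open Literature.MathematicalPhysics.QuantumFieldTheory.Balaban1983to89.B5Prop11Plancherel (Tor fine unitVec)
open Literature.MathematicalPhysics.QuantumFieldTheory.Balaban1983to89.B4TorusKernel.MultiPeriod
  (circAbs circAbs_add_mul circAbs_of_centred)
open Literature.MathematicalPhysics.QuantumFieldTheory.King1986.Torus
  (tdistT tdistT_symm tdistT_add_unitVec_le circAbs_le_tdistT)
open Summit.QuantumFields.YangMills.BalabanUVNodes.N16KingModel (blockMean_sum_mul)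

variable {d : ℕ}

/-! ## §1 Shifts by multiples of a unit vector on a torus `Π_μ ℤ∕K_μ`: components, the period, neighbours at distance one -/

section Shift

variable {K : Fin d → ℕ}

/-- Components off the shift direction are unchanged: `(x + c·e_μ)_ν = x_ν` for `ν ≠ μ`. [folklore] -/
theorem add_nsmul_unitVec_apply_ne (x : Tor K) (μ : Fin d) (c : ℕ) {ν : Fin d} (hν : ν ≠ μ) :
    (x + c • unitVec K μ) ν = x ν := by
  simp [unitVec, Pi.single_eq_of_ne hν]

/-- Components off the shift direction are unchanged: `(x + e_μ)_ν = x_ν` for `ν ≠ μ`. [folklore] -/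
theorem add_unitVec_apply_ne (x : Tor K) (μ : Fin d) {ν : Fin d} (hν : ν ≠ μ) :
    (x + unitVec K μ) ν = x ν := by
  simp [unitVec, Pi.single_eq_of_ne hν]

variable [∀ μ, NeZero (K μ)]

/-- The shifted component: `(x + c·e_μ)_μ = (x_μ + c) mod K_μ` (as least residues). [folklore] -/
theorem val_add_nsmul_unitVec_apply_self (x : Tor K) (μ : Fin d) (c : ℕ) :
    ((x + c • unitVec K μ) μ).val = ((x μ).val + c) % K μ := by
  have h : (x + c • unitVec K μ) μ = x μ + (c : ZMod (K μ)) := by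
    simp [unitVec]
  rw [h, ZMod.val_add, ZMod.val_natCast, Nat.add_mod_mod]

/-- The shifted component: `(x + e_μ)_μ = (x_μ + 1) mod K_μ`. [folklore] -/
theorem val_add_unitVec_apply_self (x : Tor K) (μ : Fin d) :
    ((x + unitVec K μ) μ).val = ((x μ).val + 1) % K μ := by
  simpa using val_add_nsmul_unitVec_apply_self x μ 1

omit [∀ μ, NeZero (K μ)] in
variable (K) in
/-- **The period**: `K_μ·e_μ = 0` on `Π_μ ℤ∕K_μ`. [folklore] -/
theorem period_nsmul_unitVec (μ : Fin d) : (K μ) • unitVec K μ = (0 : Tor K) := by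
  funext ν
  by_cases hν : ν = μ
  · subst hν; simp [unitVec]
  · simp [unitVec, Pi.single_eq_of_ne hν]

variable (K) in
/-- **Neighbours are at torus distance EXACTLY one** (`K_μ ≥ 2`): `tdistT K (x + e_μ) x = 1` — `≤ 1` is
`UniformDecay.tdistT_add_unitVec_le`; `≥ 1` because the `μ`-th circular coordinate distance is `dist(1, K_μℤ) = 1`.
[folklore] -/
theorem tdistT_add_unitVec_eq_one {μ : Fin d} (hK : 2 ≤ K μ) (x : Tor K) : tdistT K (x + unitVec K μ) x = 1 := by
  refine le_antisymm (by rw [tdistT_symm]; exact tdistT_add_unitVec_le K x μ) ?_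
  have h := circAbs_le_tdistT K (x + unitVec K μ) x μ
  have hone : circAbs (K μ) 1 = 1 := by
    rw [circAbs_of_centred (by omega) (by rw [abs_one]; exact_mod_cast (by omega : 2 * 1 ≤ K μ)), abs_one]
  have hc : circAbs (K μ) ((((x + unitVec K μ) μ).val : ℤ) - ((x μ).val : ℤ)) = 1 := by
    rw [val_add_unitVec_apply_self]
    have hv : (x μ).val < K μ := ZMod.val_lt _
    by_cases hlt : (x μ).val + 1 < K μ
    · rw [Nat.mod_eq_of_lt hlt]
      push_cast
      rw [show ((x μ).val : ℤ) + 1 - (x μ).val = 1 by ring, hone]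
    · have heq : (x μ).val + 1 = K μ := by omega
      have hKz : ((K μ : ℕ) : ℤ) = (x μ).val + 1 := by exact_mod_cast heq.symm
      rw [heq, Nat.mod_self, Nat.cast_zero,
        show (0 : ℤ) - ((x μ).val : ℤ) = 1 + ((K μ : ℕ) : ℤ) * (-1) by rw [hKz]; ring, circAbs_add_mul, hone]
  rw [hc] at h
  exact_mod_cast h

end Shift

/-! ## §2 «x′ over x» under shifts: the fibre of `x + e_μ` is the fibre of `x` translated by `Lⁿ·e_μ`; the dichotomy for `x′ + j·e_μ` -/

section Over

variable {L : ℕ} [NeZero L] {M : Fin d → ℕ} [∀ μ, NeZero (M μ)] {k n : ℕ}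

/-- Arithmetic: if the remainder does not overflow, `⌊(v + j)∕R⌋ = ⌊v∕R⌋`. [folklore] -/
theorem div_add_eq_of_mod_add_lt {v j R : ℕ} (hR : 0 < R) (h : v % R + j < R) : (v + j) / R = v / R := by
  have hv : v + j = R * (v / R) + (v % R + j) := by have := Nat.div_add_mod v R; omega
  rw [hv, Nat.mul_add_div hR, Nat.div_eq_of_lt h, add_zero]

/-- Arithmetic: if the remainder overflows once (`j < R ≤ v mod R + j`), `⌊(v + j)∕R⌋ = ⌊v∕R⌋ + 1`. [folklore] -/
theorem div_add_eq_succ_of_le_mod_add {v j R : ℕ} (hR : 0 < R) (hj : j < R) (h : R ≤ v % R + j) :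
    (v + j) / R = v / R + 1 := by
  have hv : v + j = R * (v / R) + (v % R + j) := by have := Nat.div_add_mod v R; omega
  have hlt : v % R + j < 2 * R := by have := Nat.mod_lt v hR; omega
  have hq : (v % R + j) / R = 1 := Nat.div_eq_of_lt_le (by omega) (by omega)
  rw [hv, Nat.mul_add_div hR, hq]

/-- **Shifting both points**: if `x′ ∈ T_{η′}` lies over `x ∈ T_η` (`x_ν = ⌊x′_ν∕Lⁿ⌋`), then `x′ + cLⁿ·e_μ` lies over `x + c·e_μ`
(both tori wrap consistently: the fine period is `Lⁿ` times the coarse one). [cite: King1986, Prop. 3.8 p.664] -/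
theorem over_add_nsmul (x : Tor (fine (L ^ k) M)) (x' : Tor (fine (L ^ n * L ^ k) M))
    (hx : ∀ ν, (x ν).val = (x' ν).val / L ^ n) (μ : Fin d) (c : ℕ) :
    ∀ ν, ((x + c • unitVec (fine (L ^ k) M) μ) ν).val
      = ((x' + (c * L ^ n) • unitVec (fine (L ^ n * L ^ k) M) μ) ν).val / L ^ n := by
  have hL : 0 < L := Nat.pos_of_ne_zero (NeZero.ne L)
  have hLn : 0 < L ^ n := pow_pos hL n
  intro ν
  by_cases hν : ν = μ
  · subst hν
    rw [val_add_nsmul_unitVec_apply_self, val_add_nsmul_unitVec_apply_self, hx ν]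
    show ((x' ν).val / L ^ n + c) % (L ^ k * M ν) = ((x' ν).val + c * L ^ n) % (L ^ n * L ^ k * M ν) / L ^ n
    rw [mul_assoc, Nat.mod_mul_right_div_self, Nat.add_mul_div_right _ _ hLn]
  · rw [add_nsmul_unitVec_apply_ne _ _ _ hν, add_nsmul_unitVec_apply_ne _ _ _ hν]
    exact hx ν

/-- ★ **THE DICHOTOMY.**  If `x′` lies over `x` and `j < Lⁿ`, then the fine point `x′ + j·e_μ` lies over `x` (no carry in the `μ`-th
`Lⁿ`-adic digit) OR over `x + e_μ` (one carry) — the fine points read by the derivative of a block mean belong to the block of `x` or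
to the next block along `μ`. [cite: King1986, Prop. 3.8 p.664, (4.1) p.670] -/
theorem over_add_nsmul_cases (x : Tor (fine (L ^ k) M)) (x' : Tor (fine (L ^ n * L ^ k) M))
    (hx : ∀ ν, (x ν).val = (x' ν).val / L ^ n) (μ : Fin d) {j : ℕ} (hj : j < L ^ n) :
    (∀ ν, (x ν).val = ((x' + j • unitVec (fine (L ^ n * L ^ k) M) μ) ν).val / L ^ n) ∨
    (∀ ν, ((x + unitVec (fine (L ^ k) M) μ) ν).val
        = ((x' + j • unitVec (fine (L ^ n * L ^ k) M) μ) ν).val / L ^ n) := by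
  have hL : 0 < L := Nat.pos_of_ne_zero (NeZero.ne L)
  have hLn : 0 < L ^ n := pow_pos hL n
  have hxμ : (x μ).val = (x' μ).val / L ^ n := hx μ
  have hxlt : (x μ).val < L ^ k * M μ := ZMod.val_lt (x μ)
  by_cases hc : (x' μ).val % L ^ n + j < L ^ n
  · left
    intro ν
    by_cases hν : ν = μ
    · subst hν
      rw [val_add_nsmul_unitVec_apply_self]
      show (x ν).val = ((x' ν).val + j) % (L ^ n * L ^ k * M ν) / L ^ n
      have hsplit := Nat.div_add_mod ((x' ν).val) (L ^ n)
      have h1 : (x' ν).val + j < L ^ n * ((x' ν).val / L ^ n + 1) := by rw [mul_add, mul_one]; linarith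
      have h2 : (x' ν).val / L ^ n + 1 ≤ L ^ k * M ν := by rw [← hxμ]; exact hxlt
      have hlt : (x' ν).val + j < L ^ n * L ^ k * M ν :=
        calc (x' ν).val + j < L ^ n * ((x' ν).val / L ^ n + 1) := h1
          _ ≤ L ^ n * (L ^ k * M ν) := Nat.mul_le_mul_left _ h2
          _ = L ^ n * L ^ k * M ν := (mul_assoc _ _ _).symm
      rw [Nat.mod_eq_of_lt hlt, div_add_eq_of_mod_add_lt hLn hc, hxμ]
    · rw [add_nsmul_unitVec_apply_ne _ _ _ hν]
      exact hx ν
  · right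
    push Not at hc
    intro ν
    by_cases hν : ν = μ
    · subst hν
      rw [val_add_unitVec_apply_self, val_add_nsmul_unitVec_apply_self, hxμ]
      show ((x' ν).val / L ^ n + 1) % (L ^ k * M ν) = ((x' ν).val + j) % (L ^ n * L ^ k * M ν) / L ^ n
      rw [mul_assoc, Nat.mod_mul_right_div_self, div_add_eq_succ_of_le_mod_add hLn hj hc]
    · rw [add_unitVec_apply_ne _ _ hν, add_nsmul_unitVec_apply_ne _ _ _ hν]
      exact hx ν

/-- **Shifting back**: if `y ∈ T_{η′}` lies over `x + e_μ`, then `y − Lⁿ·e_μ` lies over `x` (shift forward `K_μ − 1` more times,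
`K_μ = LᵏM_μ` the coarse period, and use the periods of both tori). [cite: King1986, Prop. 3.8 p.664] -/
theorem over_sub_nsmul (x : Tor (fine (L ^ k) M)) (y : Tor (fine (L ^ n * L ^ k) M)) (μ : Fin d)
    (hy : ∀ ν, ((x + unitVec (fine (L ^ k) M) μ) ν).val = (y ν).val / L ^ n) :
    ∀ ν, (x ν).val = ((y - (L ^ n) • unitVec (fine (L ^ n * L ^ k) M) μ) ν).val / L ^ n := by
  have hL : 0 < L := Nat.pos_of_ne_zero (NeZero.ne L)
  have hP1 : 1 ≤ L ^ k * M μ := Nat.one_le_iff_ne_zero.mpr (NeZero.ne (L ^ k * M μ))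
  have h := over_add_nsmul (x + unitVec (fine (L ^ k) M) μ) y hy μ (L ^ k * M μ - 1)
  have h1 : x + unitVec (fine (L ^ k) M) μ + (L ^ k * M μ - 1) • unitVec (fine (L ^ k) M) μ = x := by
    rw [add_assoc, ← succ_nsmul', Nat.sub_add_cancel hP1]
    exact (congrArg (x + ·) (period_nsmul_unitVec (fine (L ^ k) M) μ)).trans (add_zero x)
  have hPR : (L ^ k * M μ - 1) * L ^ n + L ^ n = fine (L ^ n * L ^ k) M μ := by
    show (L ^ k * M μ - 1) * L ^ n + L ^ n = L ^ n * L ^ k * M μ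
    rw [Nat.sub_one_mul, Nat.sub_add_cancel (Nat.le_mul_of_pos_left _ hP1)]
    ring
  have h2 : y + ((L ^ k * M μ - 1) * L ^ n) • unitVec (fine (L ^ n * L ^ k) M) μ
      = y - (L ^ n) • unitVec (fine (L ^ n * L ^ k) M) μ := by
    rw [eq_sub_iff_add_eq, add_assoc, ← add_nsmul, hPR, period_nsmul_unitVec, add_zero]
  intro ν
  have hν := h ν
  rw [h1, h2] at hν
  exact hν

/-- **THE FIBRE OF `x + e_μ` IS THE FIBRE OF `x` TRANSLATED BY `Lⁿ·e_μ`** (as finite sets of the fine torus; `Bⁿ(x + e_μ) = Bⁿ(x) + Lⁿe_μ`).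
[cite: King1986, Prop. 3.8 p.664, (4.1) p.670] -/
theorem overFib_shift_eq_map (x : Tor (fine (L ^ k) M)) (μ : Fin d) :
    (Finset.univ.filter fun y : Tor (fine (L ^ n * L ^ k) M) =>
        ∀ ν, ((x + unitVec (fine (L ^ k) M) μ) ν).val = (y ν).val / L ^ n)
      = (Finset.univ.filter fun x' : Tor (fine (L ^ n * L ^ k) M) => ∀ ν, (x ν).val = (x' ν).val / L ^ n).map
          (addRightEmbedding ((L ^ n) • unitVec (fine (L ^ n * L ^ k) M) μ)) := by
  ext y
  simp only [Finset.mem_map, Finset.mem_filter, Finset.mem_univ, true_and, addRightEmbedding_apply]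
  constructor
  · intro hy
    exact ⟨y - (L ^ n) • unitVec (fine (L ^ n * L ^ k) M) μ, over_sub_nsmul x y μ hy, sub_add_cancel _ _⟩
  · rintro ⟨x', hx', rfl⟩
    have h := over_add_nsmul x x' hx' μ 1
    simpa only [one_nsmul, one_mul] using h

end Over

/-! ## §3 Block means under the shift, telescoping, and ★ the block-mean ∕ difference commutation -/

section BlockMean

variable {L : ℕ} [NeZero L] (M : Fin d → ℕ) [∀ μ, NeZero (M μ)] {k n : ℕ}

/-- **The block mean at `x + e_μ` is the mean over the fibre of `x` of the `Lⁿ·e_μ`-translate**: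
`(Q_nf)(x + e_μ) = |Bⁿ(x)|⁻¹ Σ_{x′ over x} f(x′ + Lⁿ·e_μ)`. [cite: King1986, (2.4) p.652, (4.1) p.670] -/
theorem blockMean_shift (x : Tor (fine (L ^ k) M)) (μ : Fin d) (f : Tor (fine (L ^ n * L ^ k) M) → ℝ) :
    (((Finset.univ.filter fun y : Tor (fine (L ^ n * L ^ k) M) =>
          ∀ ν, ((x + unitVec (fine (L ^ k) M) μ) ν).val = (y ν).val / L ^ n).card : ℝ))⁻¹ *
        ∑ y ∈ (Finset.univ.filter fun y : Tor (fine (L ^ n * L ^ k) M) =>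
          ∀ ν, ((x + unitVec (fine (L ^ k) M) μ) ν).val = (y ν).val / L ^ n), f y
      = (((Finset.univ.filter fun x' : Tor (fine (L ^ n * L ^ k) M) => ∀ ν, (x ν).val = (x' ν).val / L ^ n).card : ℝ))⁻¹ *
        ∑ x' ∈ (Finset.univ.filter fun x' : Tor (fine (L ^ n * L ^ k) M) => ∀ ν, (x ν).val = (x' ν).val / L ^ n),
          f (x' + (L ^ n) • unitVec (fine (L ^ n * L ^ k) M) μ) := by
  rw [overFib_shift_eq_map, Finset.card_map, Finset.sum_map]
  rfl

/-- **Telescoping along `μ`**: `f(y + R·e) − f(y) = Σ_{j<R} (f(y + j·e + e) − f(y + j·e))`. [folklore] -/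
theorem sub_eq_sum_range {T : Type*} [AddCommMonoid T] (f : T → ℝ) (y e : T) (R : ℕ) :
    f (y + R • e) - f y = ∑ j ∈ Finset.range R, (f (y + j • e + e) - f (y + j • e)) := by
  have h := Finset.sum_range_sub (fun j => f (y + j • e)) R
  simp only [succ_nsmul, ← add_assoc, zero_nsmul, add_zero] at h
  exact h.symm

/-- ★ **THE BLOCK-MEAN ∕ DIFFERENCE COMMUTATION.**  For every function `f` on the fine torus `T_{η′}` (`η′⁻¹ = LⁿLᵏ`), every coarse
point `x ∈ T_η` (`η⁻¹ = Lᵏ`) and direction `μ`, the coarse forward difference of the `n`-fold block mean is the double mean of the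
fine forward differences:
`Lᵏ·((Q_nf)(x + e_μ) − (Q_nf)(x)) = |Bⁿ(x)|⁻¹ Σ_{x′ over x} L⁻ⁿ Σ_{j<Lⁿ} LⁿLᵏ·(f(x′ + j·e_μ + e_μ) − f(x′ + j·e_μ))`
(`blockMean_shift` + `sub_eq_sum_range`; `η⁻¹ = Lⁿ·L⁻ⁿ·η′⁻¹`).  The fine points `x′ + j·e_μ` lie over `x` or over `x + e_μ`
(`over_add_nsmul_cases`). [cite: King1986, (2.4) p.652, Prop. 3.8 (3.71) p.664, (4.1) p.670] -/
theorem coarseDeriv_blockMean_eq (x : Tor (fine (L ^ k) M)) (μ : Fin d) (f : Tor (fine (L ^ n * L ^ k) M) → ℝ) :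
    ((L ^ k : ℕ) : ℝ) *
        ((((Finset.univ.filter fun y : Tor (fine (L ^ n * L ^ k) M) =>
              ∀ ν, ((x + unitVec (fine (L ^ k) M) μ) ν).val = (y ν).val / L ^ n).card : ℝ))⁻¹ *
            ∑ y ∈ (Finset.univ.filter fun y : Tor (fine (L ^ n * L ^ k) M) =>
              ∀ ν, ((x + unitVec (fine (L ^ k) M) μ) ν).val = (y ν).val / L ^ n), f y
          - (((Finset.univ.filter fun x' : Tor (fine (L ^ n * L ^ k) M) => ∀ ν, (x ν).val = (x' ν).val / L ^ n).card : ℝ))⁻¹ *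
            ∑ x' ∈ (Finset.univ.filter fun x' : Tor (fine (L ^ n * L ^ k) M) => ∀ ν, (x ν).val = (x' ν).val / L ^ n), f x')
      = (((Finset.univ.filter fun x' : Tor (fine (L ^ n * L ^ k) M) => ∀ ν, (x ν).val = (x' ν).val / L ^ n).card : ℝ))⁻¹ *
        ∑ x' ∈ (Finset.univ.filter fun x' : Tor (fine (L ^ n * L ^ k) M) => ∀ ν, (x ν).val = (x' ν).val / L ^ n),
          ((((L ^ n : ℕ) : ℝ))⁻¹ * ∑ j ∈ Finset.range (L ^ n),
            ((L ^ n * L ^ k : ℕ) : ℝ) *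
              (f (x' + j • unitVec (fine (L ^ n * L ^ k) M) μ + unitVec (fine (L ^ n * L ^ k) M) μ)
                - f (x' + j • unitVec (fine (L ^ n * L ^ k) M) μ))) := by
  have hL : (L : ℝ) ≠ 0 := by exact_mod_cast NeZero.ne L
  have hx' : ∀ x' : Tor (fine (L ^ n * L ^ k) M),
      (((L ^ n : ℕ) : ℝ))⁻¹ * ∑ j ∈ Finset.range (L ^ n),
          ((L ^ n * L ^ k : ℕ) : ℝ) *
            (f (x' + j • unitVec (fine (L ^ n * L ^ k) M) μ + unitVec (fine (L ^ n * L ^ k) M) μ)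
              - f (x' + j • unitVec (fine (L ^ n * L ^ k) M) μ))
        = ((L ^ k : ℕ) : ℝ) * (f (x' + (L ^ n) • unitVec (fine (L ^ n * L ^ k) M) μ) - f x') := by
    intro x'
    rw [← Finset.mul_sum, ← sub_eq_sum_range f x' _ (L ^ n)]
    push_cast
    field_simp
  simp only [hx']
  rw [blockMean_shift, ← mul_sub, ← Finset.sum_sub_distrib, ← Finset.mul_sum]
  ring

/-- A mean of terms `≤ C` is `≤ C` (non-empty index set). [folklore] -/
theorem blockMean_le {α : Type*} {s : Finset α} (hs : s.Nonempty) {f : α → ℝ} {C : ℝ} (h : ∀ x ∈ s, f x ≤ C) :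
    ((s.card : ℝ))⁻¹ * ∑ x ∈ s, f x ≤ C := by
  have hc : (0 : ℝ) < s.card := by exact_mod_cast hs.card_pos
  calc ((s.card : ℝ))⁻¹ * ∑ x ∈ s, f x ≤ ((s.card : ℝ))⁻¹ * ∑ _x ∈ s, C :=
        mul_le_mul_of_nonneg_left (Finset.sum_le_sum h) (inv_pos.2 hc).le
    _ = C := by rw [Finset.sum_const, nsmul_eq_mul, ← mul_assoc, inv_mul_cancel₀ hc.ne', one_mul]

/-- `|mean f| ≤ mean |f|`. [folklore] -/
theorem abs_blockMean_le {α : Type*} (s : Finset α) (f : α → ℝ) :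
    |((s.card : ℝ))⁻¹ * ∑ x ∈ s, f x| ≤ ((s.card : ℝ))⁻¹ * ∑ x ∈ s, |f x| := by
  rw [abs_mul, abs_of_nonneg (inv_nonneg.2 (Nat.cast_nonneg _))]
  exact mul_le_mul_of_nonneg_left (Finset.abs_sum_le_sum_abs _ _) (inv_nonneg.2 (Nat.cast_nonneg _))

/-- The mean commutes with a finite sum over an external index: `mean_x Σ_b g_b(x) = Σ_b mean_x g_b(x)`. [folklore] -/
theorem blockMean_sum_comm {α β : Type*} [Fintype β] (s : Finset α) (g : β → α → ℝ) :
    ((s.card : ℝ))⁻¹ * ∑ x ∈ s, ∑ b, g b x = ∑ b, ((s.card : ℝ))⁻¹ * ∑ x ∈ s, g b x := by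
  simpa using blockMean_sum_mul s (fun _ => (1 : ℝ)) g

end BlockMean

end Summit.QuantumFields.YangMills.BalabanUVNodes.N16KingModelBlockShift

end
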